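import Summits.QuantumFields.BalabanUV.Beta.D1BFx.DressedBubbleTable

/-!
# `BalabanUV.Beta.D1BFx.DressedTadpoleTable` — road «BF-x» for binder row D1, leaf A4 (part 3): THE TADPOLE PART AND THE WHOLE
# REDUCED ONE-SHOT KERNEL — for a second-order FINE table family `Wf κ′ u λ′ u′` dressed by `ℋ ⊗ ℋ` (`tableRed n Wf`, the socket T5
# delivers into), `½·tadpole (Ga) (tableRed Wf μ 0 ν z) = dressedEntryP (wK n) (tadpoleTable) (n•(−z)) μ ν`; hence
# `TOfRed n a S (tableRed n Wf) μ ν z = dressedEntryP (wK n) (fineHess n a S Wf) (n•(−z)) μ ν` with the FINE HESSIAN KERNEL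
# `fineHess = ½·tadpole-table − ½·bubble-table`, and (K-R5) `n⁸ · secondMoment (TOfRed …) μ ν = avgM2 n (fineHess μ ν)` given the
# per-entry Ward row sums and parity first moments of `fineHess` — the dressing cross terms `X_n` of the whole reduced kernel VANISH

HONEST FRAMING (cell contract, verbatim): «discharging `BetaPertH` makes Bałaban's UV stability UNCONDITIONAL — a real
constructive-QFT result; it is NOT the continuum limit and NOT the Clay problem.»  Three definitions with bodies ([our object]: `tableRed`,
`tadpoleTable`, `fineHess`) and [folklore] bookkeeping composed BY NAME from parts 1–2 of this leaf (`DressedBubbleBridge`,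
`DressedBubbleTable`), T1/T8 (`GluonLeg`, `ReducedKernel.TOfRed`) and K-R5 (`MomentTransferPeriodicEntry.bondSecondMomentP_solutionOp_four`).
HYPOTHESES THAT STAY HYPOTHESES: `Spr (Ga n a)` (T1's decay binder), the per-entry ROW SUMS of `fineHess` (`hrow` — the kernel form of the
Ward identity of the gauge-invariant piece, node A3.b / an2 Lemma W) and its base-point-summed FIRST MOMENTS (`hT1` — reflection parity, node
R5 (T1)); the fine table family `Wf` itself is T5's object (OPEN) — nothing about Bałaban's tables is asserted.  No `Prop` fact minted; no
citation; nothing of D1 / BetaPertH discharged.  Value = kernel bookkeeping leaf of road BF-x (skeleton `HOME/beta/skeletons/D1-b2b-balaban-beta-d1-p2.md`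
v1.4 nodes R4/R5/A4), NOT summit progress; NOT continuum, NOT Clay.  HONEST DEPENDENCY (verbatim): continuum YM on T⁴ ⇐ BetaPertH ∧
nine spine estimates (0/9 proved); BetaPertH ⇐ (D1) ∧ (D4) ∧ CAP+tail; G-an2-4 gates asym, D1 and NE2/3/4.

CONTENT:
* §1 [folklore, generic `D`, `F`] `biLoc_wsum_snd` (superposition of a family localised at `(q, u′)` with weights decaying from `p′` is
  localised at `(q, p′)`), `exists_tadpole_bound`, **`tadpole_wsum_wsum`**.
* §2 [our object] `Table₂R`, `tableRed`, `tadpoleTable`; [folklore] `isBlockPeriodic_tadpoleTable`, `absMoment₂_baseKer_tadpoleTable`,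
  **`tadpole_tableRed`**, **`tadpolePart_eq_dressedEntryP`**.
* §3 [our object] `fineHess`; [folklore] **`TOfRed_tableRed_eq_dressedEntryP`**, **`bondSecondMoment_TOfRed_eq_avgM2`**, `secondMoment_TOfRed_eq`.
-/

noncomputable section

namespace Summit.QuantumFields.BalabanUV.Beta.D1BFx.DressedTadpoleTable

open Finset
open scoped BigOperators
open Literature.MathematicalPhysics.QuantumFieldTheory.Balaban1983to89
open Literature.MathematicalPhysics.QuantumFieldTheory.Balaban1983to89.Beta
open B12Sec2to5 (l1 l1_nonneg Decay510)
open ExpKernelCalculus (Site MKer Decays BiLoc comp tr bubble tadpole hessKer shiftK tadpole_shiftK Zl Zl_nonneg summable_exp_shift'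
  tsum_exp_shift' biLoc_comp_decays abs_tr_le l1_sub_triangle l1_sub_symm)
open KernelWard (bdd_of_biLoc)
open DecimatedMoment (cosetInd)
open DecimatedMomentSummable (AbsMoment₂ absMoment₂_of_decay510)
open DressedMomentNormalisation (EKer resSite)
open KernelSpecInstance (wH)
open MinimiserIdentityForm (wK)
open OneStepResolventKernel (wsum)
open Summit.QuantumFields.BalabanUV.Beta.TameKernelCalculus
open Summit.QuantumFields.BalabanUV.Beta.KernelWardRelative (loc_finset_sum tadpole_finset_sum)
open Summit.QuantumFields.BalabanUV.Beta.D1BFx.GluonLeg (Ga shiftK_Ga_neg)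
open Summit.QuantumFields.BalabanUV.Beta.D1BFx.ReducedKernel (StencilR TableR vertexRed TOfRed)
open Summit.QuantumFields.BalabanUV.Beta.D1BFx.DressedBubbleBridge
open Summit.QuantumFields.BalabanUV.Beta.D1BFx.DressedBubbleTable (bubbleTable bubbleTable_apply isBlockPeriodic_bubbleTable
  absMoment₂_baseKer_bubbleTable bubbleTable_transpose bubblePart_eq_dressedEntryP exists_expWeight_wH)
open Summit.QuantumFields.BalabanUV.Beta.D1BFx.MomentTransferPeriodic (Ker₂ IsBlockPeriodic baseKer)
open Summit.QuantumFields.BalabanUV.Beta.D1BFx.MomentTransferPeriodicSum (dressedSumP)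
open Summit.QuantumFields.BalabanUV.Beta.D1BFx.MomentTransferPeriodicEntry (EKer₂ dressedEntryP avgM2
  bondSecondMomentP_solutionOp_four)

/-! ## §1 Generic: superpositions localised at a moving second centre; the tadpole of a double superposition -/

section Generic

variable {D : ℕ} {F : Type*} [Fintype F]

omit [Fintype F] in
/-- [folklore] **WEIGHTED SUPERPOSITION, INDEX = SECOND CENTRE**: weights decaying from `p′`, a family `K u′` bi-localised at `(q, u′)` ⟹
`Σ'_{u′} w_{u′} K_{u′}` is bi-localised at `(q, p′)` with constant `C·Cₖ·Zl(δ/2)` and rate `δ/2` (the twin of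
`OneStepResolventKernel.biLoc_wsum`, whose family is localised at `(u′, u′)`). -/
theorem biLoc_wsum_snd {w : Site D → ℝ} {K : Site D → MKer D F} {C Ck δ : ℝ} {p' q : Site D}
    (hw : ∀ u, |w u| ≤ C * Real.exp (-δ * l1 (u - p'))) (hK : ∀ u, BiLoc (K u) q u Ck δ) (hδ : 0 < δ) (hC : 0 ≤ C) :
    BiLoc (wsum w K) q p' (C * Ck * Zl D (δ / 2)) (δ / 2) := by
  intro x z a b
  unfold OneStepResolventKernel.wsum
  have hCk : 0 ≤ Ck := (hK p').nonneg a
  have hterm : ∀ u, |w u * K u x z a b| ≤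
      C * Ck * Real.exp (-(δ / 2) * (l1 (x - q) + l1 (z - p'))) * Real.exp (-(δ / 2) * l1 (u - z)) := by
    intro u
    rw [abs_mul]
    have h1 := hw u
    have h2 := hK u x z a b
    calc |w u| * |K u x z a b| ≤ (C * Real.exp (-δ * l1 (u - p'))) * (Ck * Real.exp (-δ * (l1 (x - q) + l1 (z - u)))) :=
          mul_le_mul h1 h2 (abs_nonneg _) ((abs_nonneg _).trans h1)
      _ = C * Ck * Real.exp (-δ * l1 (u - p') + -δ * (l1 (x - q) + l1 (z - u))) := by rw [Real.exp_add]; ring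
      _ ≤ C * Ck * Real.exp (-(δ / 2) * (l1 (x - q) + l1 (z - p')) + -(δ / 2) * l1 (u - z)) := by
          refine mul_le_mul_of_nonneg_left (Real.exp_le_exp.2 ?_) (mul_nonneg hC hCk)
          have t1 : l1 (z - p') ≤ l1 (z - u) + l1 (u - p') := l1_sub_triangle z u p'
          have e1 : l1 (u - z) = l1 (z - u) := l1_sub_symm u z
          nlinarith [l1_nonneg (x - q), l1_nonneg (z - u), l1_nonneg (u - p'), hδ.le]
      _ = _ := by rw [Real.exp_add]; ring
  have hs := summable_exp_shift' (half_pos hδ) z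
  have hmaj := hs.mul_left (C * Ck * Real.exp (-(δ / 2) * (l1 (x - q) + l1 (z - p'))))
  have hb := tsum_of_norm_bounded hmaj.hasSum (fun u => by rw [Real.norm_eq_abs]; exact hterm u)
  rw [Real.norm_eq_abs] at hb
  refine hb.trans (le_of_eq ?_)
  rw [tsum_mul_left, tsum_exp_shift']
  ring

omit [Fintype F] in
/-- [folklore] **WEIGHTED SUPERPOSITION, INDEX = FIRST CENTRE**: weights decaying from `p`, a family `K u` bi-localised at `(u, q)` ⟹
`Σ'_u w_u K_u` is bi-localised at `(p, q)` with constant `C·Cₖ·Zl(δ/2)` and rate `δ/2`. -/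
theorem biLoc_wsum_fst {w : Site D → ℝ} {K : Site D → MKer D F} {C Ck δ : ℝ} {p q : Site D}
    (hw : ∀ u, |w u| ≤ C * Real.exp (-δ * l1 (u - p))) (hK : ∀ u, BiLoc (K u) u q Ck δ) (hδ : 0 < δ) (hC : 0 ≤ C) :
    BiLoc (wsum w K) p q (C * Ck * Zl D (δ / 2)) (δ / 2) := by
  intro x z a b
  unfold OneStepResolventKernel.wsum
  have hCk : 0 ≤ Ck := (hK p).nonneg a
  have hterm : ∀ u, |w u * K u x z a b| ≤
      C * Ck * Real.exp (-(δ / 2) * (l1 (x - p) + l1 (z - q))) * Real.exp (-(δ / 2) * l1 (u - x)) := by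
    intro u
    rw [abs_mul]
    have h1 := hw u
    have h2 := hK u x z a b
    calc |w u| * |K u x z a b| ≤ (C * Real.exp (-δ * l1 (u - p))) * (Ck * Real.exp (-δ * (l1 (x - u) + l1 (z - q)))) :=
          mul_le_mul h1 h2 (abs_nonneg _) ((abs_nonneg _).trans h1)
      _ = C * Ck * Real.exp (-δ * l1 (u - p) + -δ * (l1 (x - u) + l1 (z - q))) := by rw [Real.exp_add]; ring
      _ ≤ C * Ck * Real.exp (-(δ / 2) * (l1 (x - p) + l1 (z - q)) + -(δ / 2) * l1 (u - x)) := by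
          refine mul_le_mul_of_nonneg_left (Real.exp_le_exp.2 ?_) (mul_nonneg hC hCk)
          have t1 : l1 (x - p) ≤ l1 (x - u) + l1 (u - p) := l1_sub_triangle x u p
          have e1 : l1 (u - x) = l1 (x - u) := l1_sub_symm u x
          nlinarith [l1_nonneg (z - q), l1_nonneg (x - u), l1_nonneg (u - p), hδ.le]
      _ = _ := by rw [Real.exp_add]; ring
  have hs := summable_exp_shift' (half_pos hδ) x
  have hmaj := hs.mul_left (C * Ck * Real.exp (-(δ / 2) * (l1 (x - p) + l1 (z - q))))
  have hb := tsum_of_norm_bounded hmaj.hasSum (fun u => by rw [Real.norm_eq_abs]; exact hterm u)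
  rw [Real.norm_eq_abs] at hb
  refine hb.trans (le_of_eq ?_)
  rw [tsum_mul_left, tsum_exp_shift']
  ring

omit [Fintype F] in
/-- [folklore] `|Σ'_{u′} w′_{u′} t_{u′}| ≤ (Σ'_{u′} |w′_{u′}|) · B` for `|t| ≤ B` and absolutely summable weights. -/
theorem abs_tsum_wmul_le {w' : Site D → ℝ} {t : Site D → ℝ} (hw' : Summable fun u => |w' u|) {B : ℝ}
    (hB : ∀ u', |t u'| ≤ B) : |∑' u', w' u' * t u'| ≤ (∑' u', |w' u'|) * B := by
  have hs : Summable fun u' => |w' u'| * B := hw'.mul_right B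
  have h := tsum_of_norm_bounded hs.hasSum
    (f := fun u' => w' u' * t u') (fun u' => by
      rw [Real.norm_eq_abs, abs_mul]; exact mul_le_mul_of_nonneg_left (hB u') (abs_nonneg _))
  rw [Real.norm_eq_abs, tsum_mul_right] at h
  exact h

variable [Nonempty F]

/-- [folklore] A UNIFORM BOUND for the tadpoles of a doubly indexed family `W u u′` bi-localised at `(u, u′)` against a spread resolvent. -/
theorem exists_tadpole_bound {A : MKer D F} {W : Site D → Site D → MKer D F} (hA : Spr A) {Cw δ : ℝ}
    (hW : ∀ u u', BiLoc (W u u') u u' Cw δ) (hδ : 0 < δ) : ∃ B : ℝ, 0 ≤ B ∧ ∀ u u', |tadpole A (W u u')| ≤ B := by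
  obtain ⟨CA, δA, hδA, hAd⟩ := hA
  set m : ℝ := min δA δ
  have hm0 : 0 < m := lt_min hδA hδ
  have hm2 : 0 < m / 2 := half_pos hm0
  have hAd' : Decays A (|CA|) m := decays_of_le hAd (min_le_left _ _)
  have hW' : ∀ u u', BiLoc (W u u') u u' (|Cw|) m := fun u u' => biLoc_of_le (hW u u') (min_le_right _ _)
  set C1 : ℝ := (Fintype.card F : ℝ) * (|CA| * |Cw|) * Zl D (m - m / 2)
  have hC10 : 0 ≤ C1 := mul_nonneg (by positivity) (Zl_nonneg (by linarith))
  refine ⟨(Fintype.card F : ℝ) * C1 * Zl D (m / 2 / 2), mul_nonneg (by positivity) (Zl_nonneg (by linarith)), fun u u' => ?_⟩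
  have h1 : BiLoc (comp A (W u u')) u u' C1 (m / 2) := biLoc_comp_decays hAd' (hW' u u') hm2.le (by linarith)
  refine (abs_tr_le h1 hm2).trans ?_
  exact mul_le_of_le_one_right (mul_nonneg (by positivity) (Zl_nonneg (by linarith)))
    (Real.exp_le_one_iff.2 (by nlinarith [l1_nonneg (u - u')]))

/-- [folklore] **THE TADPOLE OF A DOUBLE SUPERPOSITION**: spread `A`, weights decaying from `p` and `p′`, a family `W u u′` bi-localised at
`(u, u′)`: `tadpole A (Σ'_u w_u (Σ'_{u′} w′_{u′} W u u′)) = Σ'_{(u,u′)} w_u w′_{u′} · tadpole A (W u u′)` (`tadpole_wsum_fst` outside,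
`tadpole_wsum_snd` inside, `Summable.tsum_prod'`). -/
theorem tadpole_wsum_wsum {A : MKer D F} {w w' : Site D → ℝ} {W : Site D → Site D → MKer D F} (hA : Spr A)
    {Cw δw : ℝ} {p : Site D} (hw : ∀ u, |w u| ≤ Cw * Real.exp (-δw * l1 (u - p))) (hδw : 0 < δw)
    {Cw' δw' : ℝ} {p' : Site D} (hw' : ∀ u, |w' u| ≤ Cw' * Real.exp (-δw' * l1 (u - p'))) (hCw' : 0 ≤ Cw') (hδw' : 0 < δw')
    {C2 δ : ℝ} (hW : ∀ u u', BiLoc (W u u') u u' C2 δ) (hδ : 0 < δ) :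
    tadpole A (wsum w (fun u => wsum w' (W u))) = ∑' q : Site D × Site D, w q.1 * w' q.2 * tadpole A (W q.1 q.2) := by
  have hwabs : Summable fun u => |w u| := summable_abs_of_expWeight hw hδw
  have hw'abs : Summable fun u => |w' u| := summable_abs_of_expWeight hw' hδw'
  -- the inner superpositions are localised at `(u, p')`, uniformly
  have hm : 0 < min δw' δ := lt_min hδw' hδ
  have hin : ∀ u, BiLoc (wsum w' (W u)) u p' (Cw' * |C2| * Zl D (min δw' δ / 2)) (min δw' δ / 2) := fun u =>
    biLoc_wsum_snd (fun u' => expWeight_of_le hw' hCw' (min_le_left _ _) u')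
      (fun u' => biLoc_of_le (hW u u') (min_le_right _ _)) hm hCw'
  rw [tadpole_wsum_fst hA hwabs hin (half_pos hm)]
  have hstep : ∀ u, tadpole A (wsum w' (W u)) = ∑' u', w' u' * tadpole A (W u u') := fun u =>
    tadpole_wsum_snd hA hw'abs (fun u' => hW u u') hδ
  simp_rw [hstep]
  obtain ⟨B, hB0, hB⟩ := exists_tadpole_bound hA hW hδ
  have hsum : Summable fun q : Site D × Site D => w q.1 * w' q.2 * tadpole A (W q.1 q.2) := by
    refine Summable.of_norm_bounded ((hwabs.mul_of_nonneg hw'abs (fun u => abs_nonneg _) (fun u => abs_nonneg _)).mul_right B)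
      (fun q => ?_)
    rw [Real.norm_eq_abs, abs_mul, abs_mul]
    exact mul_le_mul_of_nonneg_left (hB q.1 q.2) (mul_nonneg (abs_nonneg _) (abs_nonneg _))
  rw [Summable.tsum_prod' hsum (fun u => ?_)]
  · refine tsum_congr fun u => ?_
    rw [← tsum_mul_left]
    exact tsum_congr fun u' => by ring
  · refine Summable.of_norm_bounded ((hw'abs.mul_left (|w u|)).mul_right B) (fun u' => ?_)
    rw [Real.norm_eq_abs, abs_mul, abs_mul]
    exact mul_le_mul_of_nonneg_left (hB u u') (mul_nonneg (abs_nonneg _) (abs_nonneg _))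

end Generic

/-! ## §2 The road's instance: doubly `ℋ`-dressed fine tables and the tadpole table -/

variable (n : ℕ) [NeZero n] (a : ℝ)

/-- [our object] The type of a second-order FINE table family: `Wf κ′ u λ′ u′ : MKer 4 (Fin 4)`, indexed by two fine bonds (T5's `Wbf n …`
is one). -/
abbrev Table₂R : Type := Fin 4 → Site 4 → Fin 4 → Site 4 → MKer 4 (Fin 4)

/-- [our object] **THE DOUBLY `ℋ`-DRESSED TABLE** at the coarse bonds `(μ, y)`, `(ν, y′)` (blocking `n`):
`Σ_{κ′} Σ'_u ℋ_{(κ′,u),(μ,y)} · Σ_{λ′} Σ'_{u′} ℋ_{(λ′,u′),(ν,y′)} · Wf κ′ u λ′ u′` — the chain rule through the minimiser response on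
BOTH legs of a second-order fine table (the socket into which T5 delivers `Wbf`, making T8's abstract `W := tableRed n Wbf`).  A DEFINITION. -/
def tableRed (Wf : Table₂R) (μ : Fin 4) (y : Site 4) (ν : Fin 4) (y' : Site 4) : MKer 4 (Fin 4) :=
  fun x z a b => ∑ κ' : Fin 4, wsum (fun u => wH (N := n) (d := 3) κ' μ (u - (n : ℤ) • y))
    (fun u => fun x z a b => ∑ l' : Fin 4, wsum (fun u' => wH (N := n) (d := 3) l' ν (u' - (n : ℤ) • y')) (Wf κ' u l') x z a b)
    x z a b

/-- [our object] **THE FINE TADPOLE TABLE**: `tadpoleTable n a Wf κ′ λ′ u u′ := ½ · tadpole (Ga n a) (Wf κ′ u λ′ u′)`.  A DEFINITION. -/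
def tadpoleTable (Wf : Table₂R) : EKer₂ 4 :=
  fun κ' l' u u' => (1 / 2 : ℝ) * tadpole (Ga n a) (Wf κ' u l' u')

/-- [our object] Unfolding. -/
theorem tadpoleTable_apply (Wf : Table₂R) (κ' l' : Fin 4) (u u' : Site 4) :
    tadpoleTable n a Wf κ' l' u u' = (1 / 2 : ℝ) * tadpole (Ga n a) (Wf κ' u l' u') := rfl

/-- [folklore] BLOCK PERIODICITY of the tadpole table for a jointly fine-translation-covariant table family
(`Wf κ′ (u+v) λ′ (u′+v) = shiftK (−v) (Wf κ′ u λ′ u′)`), by `shiftK_Ga_neg` + `tadpole_shiftK`. -/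
theorem isBlockPeriodic_tadpoleTable (hn : 1 ≤ n) {Wf : Table₂R}
    (hWcov : ∀ (κ' : Fin 4) (u : Site 4) (l' : Fin 4) (u' v : Site 4), Wf κ' (u + v) l' (u' + v) = shiftK (-v) (Wf κ' u l' u'))
    (κ' l' : Fin 4) : IsBlockPeriodic n (tadpoleTable n a Wf κ' l') := by
  intro t s s'
  simp only [tadpoleTable_apply]
  rw [hWcov κ' s l' s' ((n : ℤ) • t)]
  conv_lhs => rw [← shiftK_Ga_neg n a hn t]
  rw [tadpole_shiftK]

/-- [folklore] EXPONENTIAL LOCALISATION of the tadpole table in the separation, one `(C′, δ′)` for all entries and base points. -/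
theorem exists_decay_tadpoleTable {Wf : Table₂R} (hGa : Spr (Ga n a)) {C2 δ : ℝ}
    (hW : ∀ κ' u l' u', BiLoc (Wf κ' u l' u') u u' C2 δ) (hδ : 0 < δ) :
    ∃ C' δ' : ℝ, 0 < δ' ∧ ∀ (κ' l' : Fin 4) (b : Site 4), Decay510 (baseKer (tadpoleTable n a Wf κ' l') b) C' δ' := by
  obtain ⟨CA, δA, hδA, hAd⟩ := hGa
  set m : ℝ := min δA δ with hm
  have hm0 : 0 < m := lt_min hδA hδ
  have hm2 : 0 < m / 2 := half_pos hm0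
  have hAd' : Decays (Ga n a) (|CA|) m := decays_of_le hAd (min_le_left _ _)
  have hW' : ∀ κ' u l' u', BiLoc (Wf κ' u l' u') u u' (|C2|) m := fun κ' u l' u' => biLoc_of_le (hW κ' u l' u') (min_le_right _ _)
  set C1 : ℝ := (Fintype.card (Fin 4) : ℝ) * (|CA| * |C2|) * Zl 4 (m - m / 2)
  have hC10 : 0 ≤ C1 := mul_nonneg (by positivity) (Zl_nonneg (by linarith))
  refine ⟨1 / 2 * ((Fintype.card (Fin 4) : ℝ) * C1 * Zl 4 (m / 2 / 2)), m / 2 / 2, by positivity, fun κ' l' b t => ?_⟩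
  have h1 : BiLoc (comp (Ga n a) (Wf κ' (b + t) l' b)) (b + t) b C1 (m / 2) :=
    biLoc_comp_decays hAd' (hW' κ' (b + t) l' b) hm2.le (by linarith)
  have h4 := abs_tr_le h1 hm2
  rw [add_sub_cancel_left] at h4
  simp only [baseKer, tadpoleTable_apply, ExpKernelCalculus.tadpole, abs_mul]
  rw [show |(1 / 2 : ℝ)| = 1 / 2 by norm_num, mul_assoc]
  exact mul_le_mul_of_nonneg_left h4 (by norm_num)

/-- [folklore] Hence absolutely summable second moments of every base-point kernel of the tadpole table. -/
theorem absMoment₂_baseKer_tadpoleTable {Wf : Table₂R} (hGa : Spr (Ga n a)) {C2 δ : ℝ}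
    (hW : ∀ κ' u l' u', BiLoc (Wf κ' u l' u') u u' C2 δ) (hδ : 0 < δ) (κ' l' : Fin 4) (b : Site 4) :
    AbsMoment₂ (baseKer (tadpoleTable n a Wf κ' l') b) := by
  obtain ⟨C', δ', hδ', h⟩ := exists_decay_tadpoleTable n a hGa hW hδ
  exact absMoment₂_of_decay510 hδ' (h κ' l' b)

/-- [folklore] `tableRed` as a finite sum of superpositions (as a kernel). -/
theorem tableRed_eq_sum_wsum (Wf : Table₂R) (μ : Fin 4) (y : Site 4) (ν : Fin 4) (y' : Site 4) :
    tableRed n Wf μ y ν y' = ∑ κ' : Fin 4, wsum (fun u => wH (N := n) (d := 3) κ' μ (u - (n : ℤ) • y))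
      (fun u => ∑ l' : Fin 4, wsum (fun u' => wH (N := n) (d := 3) l' ν (u' - (n : ℤ) • y')) (Wf κ' u l')) := by
  funext x z a' b
  simp only [tableRed, Finset.sum_apply]
  rfl

/-- [folklore] The inner superpositions `Σ_{λ′} Σ'_{u′} ℋ · Wf κ′ u λ′ u′` are localised at `(u, n•y′)`, uniformly in `u`. -/
theorem biLoc_inner {Wf : Table₂R} {C2 δ : ℝ} (hW : ∀ κ' u l' u', BiLoc (Wf κ' u l' u') u u' C2 δ) (hδ : 0 < δ)
    (ν : Fin 4) (y' : Site 4) :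
    ∃ Ci δi : ℝ, 0 < δi ∧ ∀ (κ' : Fin 4) (u : Site 4),
      BiLoc (∑ l' : Fin 4, wsum (fun u' => wH (N := n) (d := 3) l' ν (u' - (n : ℤ) • y')) (Wf κ' u l')) u ((n : ℤ) • y') Ci δi := by
  obtain ⟨Cw, δw, hCw, hδw, hw⟩ := exists_expWeight_wH n
  have hm : 0 < min δw δ := lt_min hδw hδ
  refine ⟨∑ _l' : Fin 4, Cw * |C2| * Zl 4 (min δw δ / 2), min δw δ / 2, half_pos hm, fun κ' u => ?_⟩
  have e : (∑ l' : Fin 4, wsum (fun u' => wH (N := n) (d := 3) l' ν (u' - (n : ℤ) • y')) (Wf κ' u l'))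
      = fun x z a' b => ∑ l' : Fin 4, wsum (fun u' => wH (N := n) (d := 3) l' ν (u' - (n : ℤ) • y')) (Wf κ' u l') x z a' b := by
    funext x z a' b
    simp only [Finset.sum_apply]
  rw [e]
  exact OneStepResolventKernel.biLoc_finset_sum _ fun l' _ =>
    biLoc_wsum_snd (fun u' => expWeight_of_le (hw l' ν y') hCw (min_le_left _ _) u')
      (fun u' => biLoc_of_le (hW κ' u l' u') (min_le_right _ _)) hm hCw

/-- [folklore] **THE TADPOLE OF THE DOUBLY DRESSED TABLE IS THE `ℋ ⊗ ℋ`-SUPERPOSITION OF THE FINE TADPOLES**: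
`tadpole (Ga) (tableRed Wf μ y ν y′) = Σ_{κ′λ′} Σ'_{(u,u′)} ℋ_{(κ′,u),(μ,y)} ℋ_{(λ′,u′),(ν,y′)} · tadpole (Ga) (Wf κ′ u λ′ u′)`. -/
theorem tadpole_tableRed {Wf : Table₂R} (hGa : Spr (Ga n a)) {C2 δ : ℝ} (hW : ∀ κ' u l' u', BiLoc (Wf κ' u l' u') u u' C2 δ)
    (hδ : 0 < δ) (μ : Fin 4) (y : Site 4) (ν : Fin 4) (y' : Site 4) :
    tadpole (Ga n a) (tableRed n Wf μ y ν y')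
      = ∑ κ' : Fin 4, ∑ l' : Fin 4, ∑' q : Site 4 × Site 4,
          wH (N := n) (d := 3) κ' μ (q.1 - (n : ℤ) • y) * wH (N := n) (d := 3) l' ν (q.2 - (n : ℤ) • y')
            * tadpole (Ga n a) (Wf κ' q.1 l' q.2) := by
  obtain ⟨Cw, δw, hCw, hδw, hw⟩ := exists_expWeight_wH n
  obtain ⟨Ci, δi, hδi, hin⟩ := biLoc_inner n hW hδ ν y'
  have hwabs : ∀ (κ' μ' : Fin 4) (y₀ : Site 4), Summable fun u => |wH (N := n) (d := 3) κ' μ' (u - (n : ℤ) • y₀)| :=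
    fun κ' μ' y₀ => summable_abs_of_expWeight (hw κ' μ' y₀) hδw
  -- each outer summand is localised (at `(n•y, n•y')`), so the tadpole is additive over `κ'`
  have hloc : ∀ κ' : Fin 4, Loc (wsum (fun u => wH (N := n) (d := 3) κ' μ (u - (n : ℤ) • y))
      (fun u => ∑ l' : Fin 4, wsum (fun u' => wH (N := n) (d := 3) l' ν (u' - (n : ℤ) • y')) (Wf κ' u l'))) := by
    intro κ'
    have hm : 0 < min δw δi := lt_min hδw hδi
    exact ⟨(n : ℤ) • y, (n : ℤ) • y', _, min δw δi / 2, half_pos hm,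
      biLoc_wsum_fst (fun u => expWeight_of_le (hw κ' μ y) hCw (min_le_left _ _) u)
        (fun u => biLoc_of_le (hin κ' u) (min_le_right _ _)) hm hCw⟩
  rw [tableRed_eq_sum_wsum, tadpole_finset_sum _ hGa hloc]
  refine Finset.sum_congr rfl fun κ' _ => ?_
  -- outer exchange over `u` (family localised at `(u, n•y')`)
  rw [tadpole_wsum_fst hGa (hwabs κ' μ y) (hin κ') hδi]
  -- inner: finite sum over `l'`, then exchange over `u'`
  have hstep : ∀ u, tadpole (Ga n a) (∑ l' : Fin 4, wsum (fun u' => wH (N := n) (d := 3) l' ν (u' - (n : ℤ) • y')) (Wf κ' u l'))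
      = ∑ l' : Fin 4, ∑' u', wH (N := n) (d := 3) l' ν (u' - (n : ℤ) • y') * tadpole (Ga n a) (Wf κ' u l' u') := by
    intro u
    have hm : 0 < min δw δ := lt_min hδw hδ
    rw [tadpole_finset_sum _ hGa (fun l' => ⟨u, (n : ℤ) • y', _, _, half_pos hm,
      biLoc_wsum_snd (fun u' => expWeight_of_le (hw l' ν y') hCw (min_le_left _ _) u')
        (fun u' => biLoc_of_le (hW κ' u l' u') (min_le_right _ _)) hm hCw⟩)]
    exact Finset.sum_congr rfl fun l' _ => tadpole_wsum_snd hGa (hwabs l' ν y') (fun u' => hW κ' u l' u') hδ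
  simp_rw [hstep, Finset.mul_sum]
  -- swap `Σ'_u` with `Σ_{l'}`: each summand family is summable (uniform tadpole bound)
  have hsw : ∀ l' : Fin 4, Summable fun u => wH (N := n) (d := 3) κ' μ (u - (n : ℤ) • y)
      * ∑' u', wH (N := n) (d := 3) l' ν (u' - (n : ℤ) • y') * tadpole (Ga n a) (Wf κ' u l' u') := by
    intro l'
    obtain ⟨B', -, hB'⟩ := exists_tadpole_bound hGa (fun u u' => hW κ' u l' u') hδ
    refine Summable.of_norm_bounded ((hwabs κ' μ y).mul_right
      ((∑' u', |wH (N := n) (d := 3) l' ν (u' - (n : ℤ) • y')|) * B')) (fun u => ?_)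
    rw [Real.norm_eq_abs, abs_mul]
    exact mul_le_mul_of_nonneg_left (abs_tsum_wmul_le (hwabs l' ν y') (hB' u)) (abs_nonneg _)
  rw [Summable.tsum_finsetSum (fun l' _ => hsw l')]
  refine Finset.sum_congr rfl fun l' _ => ?_
  obtain ⟨B', -, hB'⟩ := exists_tadpole_bound hGa (fun u u' => hW κ' u l' u') hδ
  have hsum : Summable fun q : Site 4 × Site 4 => wH (N := n) (d := 3) κ' μ (q.1 - (n : ℤ) • y)
      * wH (N := n) (d := 3) l' ν (q.2 - (n : ℤ) • y') * tadpole (Ga n a) (Wf κ' q.1 l' q.2) := by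
    refine Summable.of_norm_bounded (((hwabs κ' μ y).mul_of_nonneg (hwabs l' ν y') (fun u => abs_nonneg _)
      (fun u => abs_nonneg _)).mul_right B') (fun q => ?_)
    rw [Real.norm_eq_abs, abs_mul, abs_mul]
    exact mul_le_mul_of_nonneg_left (hB' q.1 q.2) (mul_nonneg (abs_nonneg _) (abs_nonneg _))
  rw [Summable.tsum_prod' hsum (fun u => ?_)]
  · refine tsum_congr fun u => ?_
    rw [← tsum_mul_left]
    exact tsum_congr fun u' => by ring
  · refine Summable.of_norm_bounded (((hwabs l' ν y').mul_left (|wH (N := n) (d := 3) κ' μ (u - (n : ℤ) • y)|)).mul_right B')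
      (fun u' => ?_)
    rw [Real.norm_eq_abs, abs_mul, abs_mul]
    exact mul_le_mul_of_nonneg_left (hB' u u') (mul_nonneg (abs_nonneg _) (abs_nonneg _))

end Summit.QuantumFields.BalabanUV.Beta.D1BFx.DressedTadpoleTable

end
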